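import Summits.BirchSwinnertonDyer.BirchSwinnertonDyer.Theorems.ResidualThetaTransportAtTwoSignedMuSeedAtTwoPlusSmoothingCoboundaryOrbit
import HarnessLib

/-!
# Smoothing coboundary XII — Frobenius descent for several embedding classes (`h_K > 1` clause of card (C)):
# silence of the coboundary constants is constant along the Frobenius orbits of the cells
# (seed crux `SignedMuSeedAtTwoPlus` stmt-BirchSwinnertonDyer-21438; parent Kμ⁺ stmt-BirchSwinnertonDyer-20689, route
# ResidualThetaTransportAtTwo; `Cruxes/SignedMuSeedAtTwoPlus/Ideas/smoothing-coboundary.md` (C): «for `h_K > 1` σ permutes the `h_K`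
# embedding classes and the same computation equates bits along σ-orbits of cells»)

Cell `bsd-wall`, width seat `bsd-wall-rtt-p4-w2` g15 (`--supports`, closes nothing).  THEOREMS ONLY; BSD is not proved by this.

Abstract form: cells `i : I`, constants `κ : I → R` in a reduced ring / domain, a map `σ : I → I` and units `ε i` with the
Frobenius relations `κ i ^ 2 = ε i * κ (σ i)` (for `h_K = 1`, `σ = id` and this is `…Orbit.frobeniusBit`: `κ ∈ {0, ε}`).

* **`frobeniusOrbit_eq_zero_iff`** — `κ i = 0 ⟺ κ (σ i) = 0`; `frobeniusOrbit_eq_zero_iff_iterate` — `κ i = 0 ⟺ κ (σ^[n] i) = 0`: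
  one silence bit per σ-ORBIT of cells;
* `frobeniusOrbit_pow_two_pow` — along the orbit `κ i ^ (2 ^ n) = (∏_{j<n} ε (σ^[j] i) ^ 2 ^ (n-1-j)) * κ (σ^[n] i)` in the
  weaker, division-free form `∃ E, IsUnit E ∧ κ i ^ 2 ^ n = E * κ (σ^[n] i)`; hence on a closed orbit (`σ^[n] i = i`)
  `κ i ^ 2 ^ n = E * κ i` — finitely many possible non-zero values (`frobeniusOrbit_closed`).

[folklore]
-/

set_option autoImplicit false
-- the Theorems namespace of this sub repeats the summit name by design (D-0017 nested layout)
set_option linter.dupNamespace false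

namespace Summit.BirchSwinnertonDyer.BirchSwinnertonDyer.Theorems.SignedMuAtTwo.SmoothingCoboundary

variable {R I : Type*} [CommRing R] (κ ε : I → R) (σ : I → I)

/-- **Silence is σ-invariant**: in a reduced ring, `κ i² = ε i·κ(σ i)` with `ε i` a unit gives `κ i = 0 ⟺ κ (σ i) = 0`. [folklore] -/
theorem frobeniusOrbit_eq_zero_iff [IsReduced R] (hε : ∀ i, IsUnit (ε i)) (h : ∀ i, κ i ^ 2 = ε i * κ (σ i)) (i : I) :
    κ i = 0 ↔ κ (σ i) = 0 := by
  constructor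
  · intro h0
    have := h i
    rw [h0, zero_pow two_ne_zero] at this
    exact ((hε i).mul_right_eq_zero).mp this.symm
  · intro h0
    have := h i
    rw [h0, mul_zero] at this
    exact IsReduced.eq_zero _ ⟨2, this⟩

/-- … hence along the whole orbit: `κ i = 0 ⟺ κ (σ^[n] i) = 0` — ONE silence bit per σ-orbit of cells. [folklore] -/
theorem frobeniusOrbit_eq_zero_iff_iterate [IsReduced R] (hε : ∀ i, IsUnit (ε i))
    (h : ∀ i, κ i ^ 2 = ε i * κ (σ i)) (n : ℕ) (i : I) : κ i = 0 ↔ κ (σ^[n] i) = 0 := by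
  induction n generalizing i with
  | zero => rfl
  | succ n ih =>
    rw [Function.iterate_succ_apply, ← ih (σ i)]
    exact frobeniusOrbit_eq_zero_iff κ ε σ hε h i

/-- Division-free orbit relation: `κ i ^ 2 ^ n = E·κ (σ^[n] i)` for some unit `E` (a product of powers of the `ε`'s). [folklore] -/
theorem frobeniusOrbit_pow_two_pow (hε : ∀ i, IsUnit (ε i)) (h : ∀ i, κ i ^ 2 = ε i * κ (σ i)) (n : ℕ) (i : I) :
    ∃ E : R, IsUnit E ∧ κ i ^ 2 ^ n = E * κ (σ^[n] i) := by
  induction n generalizing i with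
  | zero => exact ⟨1, isUnit_one, by rw [pow_zero, pow_one, one_mul, Function.iterate_zero_apply]⟩
  | succ n ih =>
    obtain ⟨E, hE, hEq⟩ := ih (σ i)
    refine ⟨ε i ^ 2 ^ n * E, (hε i).pow _ |>.mul hE, ?_⟩
    rw [pow_succ', pow_mul, h i, mul_pow, hEq, Function.iterate_succ_apply, mul_assoc]

/-- On a CLOSED orbit (`σ^[n] i = i`, e.g. `n = h_K`): `κ i ^ 2 ^ n = E·κ i` with `E` a unit, so `κ i = 0` or `κ i ^ (2 ^ n − 1) = E`
(finitely many non-zero values; `n = 1`: `κ ∈ {0, ε}` = `frobeniusBit`). [folklore] -/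
theorem frobeniusOrbit_closed [IsDomain R] (hε : ∀ i, IsUnit (ε i)) (h : ∀ i, κ i ^ 2 = ε i * κ (σ i)) {n : ℕ} {i : I}
    (hn : σ^[n] i = i) : ∃ E : R, IsUnit E ∧ (κ i = 0 ∨ κ i ^ (2 ^ n - 1) = E) := by
  obtain ⟨E, hE, hEq⟩ := frobeniusOrbit_pow_two_pow κ ε σ hε h n i
  rw [hn] at hEq
  refine ⟨E, hE, ?_⟩
  by_cases h0 : κ i = 0
  · exact Or.inl h0
  · right
    have hpos : 1 ≤ 2 ^ n := Nat.one_le_two_pow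
    have e : κ i ^ (2 ^ n - 1) * κ i = E * κ i := by
      rw [← pow_succ, Nat.sub_add_cancel hpos, hEq]
    exact mul_right_cancel₀ h0 e

end Summit.BirchSwinnertonDyer.BirchSwinnertonDyer.Theorems.SignedMuAtTwo.SmoothingCoboundary
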